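import Mathlib
import Summits.Ventures.PercRepro.PuncturedLYMMixT2Q4Weight
import Summits.Ventures.PercRepro.PuncturedLYMMixT2Q4Rows
import Summits.Ventures.PercRepro.PuncturedLYMMixT2Q4Cols

/-!
# PercRepro — (SP) FOR `2` PAIRWISE DISJOINT TRIPLES AND `4` PAIRWISE DISJOINT QUADRUPLES AT LEVEL `4` ON EVERY GROUND SET (THEOREM)
(p10, gen 41)

THE THEOREM `puncturedNMP_mix_T2_Q4`: for every finite type `α` and every family `C : Fin 6 → Finset α` of pairwise disjoint
members with `#(C i) = sz i` (`2` triples, then `4` quadruples), the punctured normalised matching property (SP) holds at level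
`4` for the rows avoiding all members — no hypothesis on the number of points. For `n ≤ 4` there is no `5`-set; for `n ≥ 5` the flow
is the class-symmetric potential flow of the instance (PuncturedLYMMixT2Q4Table1 …; univariate in `n`) lifted by `W` (…Weight): the
row identities (…Rows) and the column identities (…Cols) are the type equations, the sums over the members are grouped by
(size, value) (`sum_eq_cnt`), the lift of PuncturedLYMTypeLift turns the table into a flow with row sums `1/#P` and column sums
`1/#Y`, and gen 36's bridge gives (SP).
-/

namespace PercRepro.PuncturedLYM.Split.TypeLift.MixT2Q4

open Finset

section Main

variable {α : Type} [DecidableEq α] [Fintype α]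

/-- Two of the members' up-levels are disjoint: a `4`-set contains at most one member (sizes `≥ 3`, pairwise sums `≥ 6`). -/
theorem disjoint_upLevel_mem (C : Fin 6 → Finset α) (hcard : ∀ i, (C i).card = sz i)
    (hdisj : ∀ i l, i ≠ l → Disjoint (C i) (C l)) (i l : Fin 6) (hil : i ≠ l) :
    Disjoint (upLevel 4 (C i)) (upLevel 4 (C l)) := by
  rw [disjoint_left]
  intro X h1 h2
  rw [mem_upLevel] at h1 h2
  have := card_le_card (union_subset h1.2 h2.2)
  rw [card_union_of_disjoint (hdisj i l hil), hcard, hcard, h1.1] at this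
  have := sz_cases i
  have := sz_cases l
  omega

/-- The members occupy `22` of the `n` points. -/
theorem mem_mul_le_card (C : Fin 6 → Finset α) (hcard : ∀ i, (C i).card = sz i)
    (hdisj : ∀ i l, i ≠ l → Disjoint (C i) (C l)) : 22 ≤ Fintype.card α := by
  have h := card_le_univ ((univ : Finset (Fin 6)).biUnion C)
  rw [card_biUnion (fun i _ l _ hil => hdisj i l hil)] at h
  simp only [hcard] at h
  rw [sum_sz] at h
  exact h

/-- `#P = C(n, 4) − 2(n − 3) − 4 = Pc n` for `n = m' + 5`. -/
theorem card_punctured_mix (m' : ℕ) (hn : Fintype.card α = m' + 5) (C : Fin 6 → Finset α)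
    (hcard : ∀ i, (C i).card = sz i) (hdisj : ∀ i l, i ≠ l → Disjoint (C i) (C l)) :
    (((punctured 4 ((univ : Finset (Fin 6)).biUnion (fun i => upLevel 4 (C i)))).card : ℕ) : ℚ) =
      Pc ((m' : ℚ) + 5) := by
  unfold punctured
  have hsub : (univ : Finset (Fin 6)).biUnion (fun i => upLevel 4 (C i)) ⊆ (univ : Finset α).powersetCard 4 := by
    intro X hX
    obtain ⟨i, _, hXi⟩ := mem_biUnion.1 hX
    rw [mem_powersetCard]
    exact ⟨subset_univ X, (mem_upLevel.1 hXi).1⟩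
  have hu : ∀ i, (upLevel 4 (C i)).card = if (i : ℕ) < 2 then m' + 2 else 1 := by
    intro i
    rw [card_upLevel (by have := hcard i; have := sz_cases i; omega), hcard, hn]
    unfold sz
    split_ifs with hi
    · rw [show m' + 5 - 3 = m' + 2 by omega, show (4 : ℕ) - 3 = 1 by norm_num, Nat.choose_one_right]
    · rw [show (4 : ℕ) - 4 = 0 by norm_num, Nat.choose_zero_right]
  have hD : ((univ : Finset (Fin 6)).biUnion (fun i => upLevel 4 (C i))).card = 2 * (m' + 2) + 4 := by
    rw [card_biUnion (fun i _ l _ hil => disjoint_upLevel_mem C hcard hdisj i l hil)]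
    simp only [hu]
    rw [sum_ite, sum_const, sum_const, smul_eq_mul, smul_eq_mul]
    have h1 : (univ.filter (fun i : Fin 6 => (i : ℕ) < 2)).card = 2 := card_tri
    have h2 : (univ.filter (fun i : Fin 6 => ¬ (i : ℕ) < 2)).card = 4 := card_quad
    rw [h1, h2]
  rw [card_sdiff_of_subset hsub, card_powersetCard, card_univ, hn, hD]
  have hle : 2 * (m' + 2) + 4 ≤ (m' + 5).choose 4 := by
    have := card_le_card hsub
    rw [card_powersetCard, card_univ, hn, hD] at this
    exact this
  rw [Nat.cast_sub hle, choose_l_cast]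
  push_cast
  unfold Pc
  ring

omit [DecidableEq α] in
/-- `#Y = C(n, 5) = Yc n` for `n = m' + 5`. -/
theorem card_levelAbove_mix (m' : ℕ) (hn : Fintype.card α = m' + 5) :
    (((levelAbove α 4).card : ℕ) : ℚ) = Yc ((m' : ℚ) + 5) := by
  unfold levelAbove
  rw [card_powersetCard, card_univ, hn, choose_l1_cast]
  unfold Yc
  ring

/-! ### The theorem for `n ≥ 5` -/

/-- **THEOREM. (SP) for `2` pairwise disjoint triples and `4` pairwise disjoint quadruples at level `4` on a ground set with
`n ≥ 5` points**, by the univariate type certificate. -/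
theorem puncturedNMP_mix_of_le (m' : ℕ) (hn : Fintype.card α = m' + 5) (C : Fin 6 → Finset α)
    (hcard : ∀ i, (C i).card = sz i) (hdisj : ∀ i l, i ≠ l → Disjoint (C i) (C l)) :
    PuncturedNMP 4 ((univ : Finset (Fin 6)).biUnion (fun i => upLevel 4 (C i))) := by
  apply puncturedNMP_of_hasFlow
  rw [card_punctured_mix m' hn C hcard hdisj, card_levelAbove_mix m' hn]
  set n : ℚ := (m' : ℚ) + 5 with hn_def
  have hn5 : (5 : ℚ) ≤ n := by rw [hn_def]; linarith [(Nat.cast_nonneg m' : (0 : ℚ) ≤ m')]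
  have hn0 : (22 : ℚ) ≤ n := by
    have := mem_mul_le_card C hcard hdisj
    rw [hn] at this
    rw [hn_def]
    exact_mod_cast this
  have hd := (den_pos n (by linarith)).ne'
  have hPc := (Pc_pos n (by linarith)).ne'
  have hY := (Yc_pos n hn5).ne'
  have hbig : ∀ i l, i ≠ l → 4 + 2 ≤ (C i).card + (C l).card := by
    intro i l _
    have := hcard i
    have := hcard l
    have := sz_cases i
    have := sz_cases l
    omega
  have hfree : (freeSet C).card = m' + 5 - 22 := by
    rw [card_freeSet hdisj, hn]
    simp only [hcard]
    rw [sum_sz]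
  have hfreeq : ((freeSet C).card : ℚ) = n - 22 := by
    rw [hfree, Nat.cast_sub (by have := mem_mul_le_card C hcard hdisj; rw [hn] at this; exact this), hn_def]
    push_cast
    ring
  refine hasFlow_of_typeWeights C (fun X hX => card_eq_of_mem_punctured_family hX) _ _ (W n)
    (fun a c d => W_nonneg n hn5 a c d) ?_ ?_
  · -- the rows
    intro X hX
    have hX' := mem_punctured_family.1 hX
    have ha : ∀ i, typ C X i < sz i := by
      intro i
      have := typ_lt_card_of_not_subset C (hX'.2 i)
      rw [hcard] at this
      exact this
    have hs := sum_typ_add_fc hdisj X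
    rw [hX'.1, sum_coords _ ha] at hs
    have hc3 := cnt3_add _ ha
    have hc4 := cnt4_add _ ha
    have hfc : fc C X ≤ (freeSet C).card := fc_le_card C X
    have hfq : (4 : ℚ) - cnt3 1 (typ C X) - 2 * cnt3 2 (typ C X) - cnt4 1 (typ C X) - 2 * cnt4 2 (typ C X) - 3 * cnt4 3 (typ C X) ≤ n - 22 := by
      have h1 : ((4 - cnt3 1 (typ C X) - 2 * cnt3 2 (typ C X) - cnt4 1 (typ C X) - 2 * cnt4 2 (typ C X) - 3 * cnt4 3 (typ C X) : ℕ) : ℚ) = (4 : ℚ) - cnt3 1 (typ C X) - 2 * cnt3 2 (typ C X) - cnt4 1 (typ C X) - 2 * cnt4 2 (typ C X) - 3 * cnt4 3 (typ C X) := by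
        rw [Nat.cast_sub (by omega), Nat.cast_sub (by omega), Nat.cast_sub (by omega), Nat.cast_sub (by omega), Nat.cast_sub (by omega)]
        push_cast
        ring
      rw [← h1, ← hfreeq]
      have : 4 - cnt3 1 (typ C X) - 2 * cnt3 2 (typ C X) - cnt4 1 (typ C X) - 2 * cnt4 2 (typ C X) - 3 * cnt4 3 (typ C X) ≤ (freeSet C).card := by omega
      exact_mod_cast this
    rw [rowSum_eq]
    have e : ∀ i, (((C i \ X).card : ℕ) : ℚ) * W n (typ C X) (fc C X) (some i) =
        (fun s v => (((s - v : ℕ)) : ℚ) * (wdir n (cnt3 1 (typ C X)) (cnt3 2 (typ C X)) (cnt4 1 (typ C X)) (cnt4 2 (typ C X)) (cnt4 3 (typ C X)) (code s v) / Yc n)) (sz i) (typ C X i) := by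
      intro i
      rw [W_some, card_sdiff_eq_sub_typ, hcard]
    rw [sum_congr rfl (fun i _ => e i), sum_eq_cnt (typ C X) ha (fun s v => (((s - v : ℕ)) : ℚ) * (wdir n (cnt3 1 (typ C X)) (cnt3 2 (typ C X)) (cnt4 1 (typ C X)) (cnt4 2 (typ C X)) (cnt4 3 (typ C X)) (code s v) / Yc n)),
      card_freeSet_sdiff, Nat.cast_sub hfc, hfreeq, W_none]
    simp only [code_three, code_four, Nat.reduceSub, Nat.reduceAdd, Nat.cast_ofNat, Nat.cast_one]
    have hc30 : (cnt3 0 (typ C X) : ℚ) = 2 - ((cnt3 1 (typ C X) : ℚ) + cnt3 2 (typ C X)) := by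
      have : cnt3 0 (typ C X) = 2 - (cnt3 1 (typ C X) + cnt3 2 (typ C X)) := by omega
      rw [this, Nat.cast_sub (by omega)]
      push_cast
      ring
    have hc40 : (cnt4 0 (typ C X) : ℚ) = 4 - ((cnt4 1 (typ C X) : ℚ) + cnt4 2 (typ C X) + cnt4 3 (typ C X)) := by
      have : cnt4 0 (typ C X) = 4 - (cnt4 1 (typ C X) + cnt4 2 (typ C X) + cnt4 3 (typ C X)) := by omega
      rw [this, Nat.cast_sub (by omega)]
      push_cast
      ring
    have hcq : (fc C X : ℚ) = (4 : ℚ) - cnt3 1 (typ C X) - 2 * cnt3 2 (typ C X) - cnt4 1 (typ C X) - 2 * cnt4 2 (typ C X) - 3 * cnt4 3 (typ C X) := by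
      have : fc C X = 4 - cnt3 1 (typ C X) - 2 * cnt3 2 (typ C X) - cnt4 1 (typ C X) - 2 * cnt4 2 (typ C X) - 3 * cnt4 3 (typ C X) := by omega
      rw [this, Nat.cast_sub (by omega), Nat.cast_sub (by omega), Nat.cast_sub (by omega), Nat.cast_sub (by omega), Nat.cast_sub (by omega)]
      push_cast
      ring
    rw [hc30, hc40, wdir_two, wdir_six,
      wdir_eq_raw n (cnt3 1 (typ C X)) (cnt3 2 (typ C X)) (cnt4 1 (typ C X)) (cnt4 2 (typ C X)) (cnt4 3 (typ C X)) 0 (by norm_num) (by norm_num) hn0 hfq,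
      wdir_eq_raw n (cnt3 1 (typ C X)) (cnt3 2 (typ C X)) (cnt4 1 (typ C X)) (cnt4 2 (typ C X)) (cnt4 3 (typ C X)) 1 (by norm_num) (by norm_num) hn0 hfq,
      wdir_eq_raw n (cnt3 1 (typ C X)) (cnt3 2 (typ C X)) (cnt4 1 (typ C X)) (cnt4 2 (typ C X)) (cnt4 3 (typ C X)) 3 (by norm_num) (by norm_num) hn0 hfq,
      wdir_eq_raw n (cnt3 1 (typ C X)) (cnt3 2 (typ C X)) (cnt4 1 (typ C X)) (cnt4 2 (typ C X)) (cnt4 3 (typ C X)) 4 (by norm_num) (by norm_num) hn0 hfq,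
      wdir_eq_raw n (cnt3 1 (typ C X)) (cnt3 2 (typ C X)) (cnt4 1 (typ C X)) (cnt4 2 (typ C X)) (cnt4 3 (typ C X)) 5 (by norm_num) (by norm_num) hn0 hfq,
      wdir_eq_raw n (cnt3 1 (typ C X)) (cnt3 2 (typ C X)) (cnt4 1 (typ C X)) (cnt4 2 (typ C X)) (cnt4 3 (typ C X)) 7 (by norm_num) (by norm_num) hn0 hfq,
      hcq]
    have key := row_check n hd hPc (cnt3 1 (typ C X)) (cnt3 2 (typ C X)) (cnt4 1 (typ C X)) (cnt4 2 (typ C X)) (cnt4 3 (typ C X)) (by omega) (by omega) (by omega)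
    rw [show (1 : ℚ) / Pc n = (Yc n / Pc n) / Yc n by field_simp, ← key]
    ring
  · -- the columns
    intro Y hY
    have hYc : Y.card = 4 + 1 := (mem_cols.1 hY).2
    by_cases hmem : ∃ i₀, C i₀ ⊆ Y
    · obtain ⟨i₀, hi₀⟩ := hmem
      rw [colSum_eq_of_member (W n) hdisj hbig hYc hi₀, hcard, W_some]
      have hi : typ C Y i₀ = sz i₀ := by rw [typ_eq_card_of_subset C hi₀, hcard]
      rw [Function.update_self, hi]
      rcases sz_cases i₀ with h3 | h4
      · rw [h3]
        simp only [code_three, Nat.reduceSub]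
        rw [wdir_two]
        push_cast
        ring
      · rw [h4]
        simp only [code_four, Nat.reduceSub, Nat.reduceAdd]
        rw [wdir_six]
        push_cast
        ring
    · have hmem' : ∀ i, ¬ C i ⊆ Y := fun i h => hmem ⟨i, h⟩
      rw [colSum_eq_of_free (W n) hdisj hYc hmem']
      have hb : ∀ i, typ C Y i < sz i := by
        intro i
        have := typ_lt_card_of_not_subset C (hmem' i)
        rw [hcard] at this
        exact this
      have hs := sum_typ_add_fc hdisj Y
      rw [hYc, sum_coords _ hb] at hs
      have hc3 := cnt3_add _ hb
      have hc4 := cnt4_add _ hb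
      have hfc : fc C Y ≤ (freeSet C).card := fc_le_card C Y
      set d31 := cnt3 1 (typ C Y) with hd31
      set d32 := cnt3 2 (typ C Y) with hd32
      set d41 := cnt4 1 (typ C Y) with hd41
      set d42 := cnt4 2 (typ C Y) with hd42
      set d43 := cnt4 3 (typ C Y) with hd43
      set c := fc C Y with hc
      have e : ∀ i, ((typ C Y i : ℕ) : ℚ) * W n (Function.update (typ C Y) i (typ C Y i - 1)) c (some i) =
          (fun s v => ((v : ℕ) : ℚ) * (if code s v = 1 then wdir n (d31 - 1) d32 d41 d42 d43 0 / Yc n else if code s v = 2 then wdir n (d31 + 1) (d32 - 1) d41 d42 d43 1 / Yc n else if code s v = 4 then wdir n d31 d32 (d41 - 1) d42 d43 3 / Yc n else if code s v = 5 then wdir n d31 d32 (d41 + 1) (d42 - 1) d43 4 / Yc n else if code s v = 6 then wdir n d31 d32 d41 (d42 + 1) (d43 - 1) 5 / Yc n else 0)) (sz i) (typ C Y i) := by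
        intro i
        rw [W_some, Function.update_self]
        have h31 := cnt3_update 1 (typ C Y) i (typ C Y i - 1)
        have h32 := cnt3_update 2 (typ C Y) i (typ C Y i - 1)
        have h41 := cnt4_update 1 (typ C Y) i (typ C Y i - 1)
        have h42 := cnt4_update 2 (typ C Y) i (typ C Y i - 1)
        have h43 := cnt4_update 3 (typ C Y) i (typ C Y i - 1)
        rw [← hd31] at h31
        rw [← hd32] at h32
        rw [← hd41] at h41
        rw [← hd42] at h42
        rw [← hd43] at h43
        have hi := hb i
        by_cases hsz : (i : ℕ) < 2
        · have hs3 := sz_of_lt hsz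
          rw [hs3] at hi ⊢
          simp only [hsz, true_and, not_true_eq_false, false_and, if_false, add_zero] at h31 h32 h41 h42 h43
          rcases Nat.lt_or_ge (typ C Y i) 1 with h0 | h0
          · have hu : typ C Y i = 0 := by omega
            rw [hu]
            simp
          rcases Nat.lt_or_ge (typ C Y i) 2 with h1 | h1
          · have hu : typ C Y i = 1 := by omega
            rw [hu] at h31 h32 h41 h42 h43 ⊢
            norm_num at h31 h32 h41 h42 h43
            simp only [Nat.reduceSub]
            have e1 : cnt3 1 (Function.update (typ C Y) i 0) = d31 - 1 := by omega
            have e2 : cnt3 2 (Function.update (typ C Y) i 0) = d32 := by omega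
            have e3 : cnt4 1 (Function.update (typ C Y) i 0) = d41 := by omega
            have e4 : cnt4 2 (Function.update (typ C Y) i 0) = d42 := by omega
            have e5 : cnt4 3 (Function.update (typ C Y) i 0) = d43 := by omega
            rw [e1, e2, e3, e4, e5]
            simp [code_three]
          · have hu : typ C Y i = 2 := by omega
            rw [hu] at h31 h32 h41 h42 h43 ⊢
            norm_num at h31 h32 h41 h42 h43
            simp only [Nat.reduceSub]
            have e1 : cnt3 1 (Function.update (typ C Y) i 1) = d31 + 1 := by omega
            have e2 : cnt3 2 (Function.update (typ C Y) i 1) = d32 - 1 := by omega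
            have e3 : cnt4 1 (Function.update (typ C Y) i 1) = d41 := by omega
            have e4 : cnt4 2 (Function.update (typ C Y) i 1) = d42 := by omega
            have e5 : cnt4 3 (Function.update (typ C Y) i 1) = d43 := by omega
            rw [e1, e2, e3, e4, e5]
            simp [code_three]
        · have hs4 := sz_of_ge hsz
          rw [hs4] at hi ⊢
          simp only [hsz, true_and, not_false_eq_true, false_and, if_false, add_zero] at h31 h32 h41 h42 h43
          rcases Nat.lt_or_ge (typ C Y i) 1 with h0 | h0
          · have hu : typ C Y i = 0 := by omega
            rw [hu]
            simp
          rcases Nat.lt_or_ge (typ C Y i) 2 with h1 | h1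
          · have hu : typ C Y i = 1 := by omega
            rw [hu] at h31 h32 h41 h42 h43 ⊢
            norm_num at h31 h32 h41 h42 h43
            simp only [Nat.reduceSub]
            have e1 : cnt3 1 (Function.update (typ C Y) i 0) = d31 := by omega
            have e2 : cnt3 2 (Function.update (typ C Y) i 0) = d32 := by omega
            have e3 : cnt4 1 (Function.update (typ C Y) i 0) = d41 - 1 := by omega
            have e4 : cnt4 2 (Function.update (typ C Y) i 0) = d42 := by omega
            have e5 : cnt4 3 (Function.update (typ C Y) i 0) = d43 := by omega
            rw [e1, e2, e3, e4, e5]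
            simp [code_four]
          rcases Nat.lt_or_ge (typ C Y i) 3 with h2 | h2
          · have hu : typ C Y i = 2 := by omega
            rw [hu] at h31 h32 h41 h42 h43 ⊢
            norm_num at h31 h32 h41 h42 h43
            simp only [Nat.reduceSub]
            have e1 : cnt3 1 (Function.update (typ C Y) i 1) = d31 := by omega
            have e2 : cnt3 2 (Function.update (typ C Y) i 1) = d32 := by omega
            have e3 : cnt4 1 (Function.update (typ C Y) i 1) = d41 + 1 := by omega
            have e4 : cnt4 2 (Function.update (typ C Y) i 1) = d42 - 1 := by omega
            have e5 : cnt4 3 (Function.update (typ C Y) i 1) = d43 := by omega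
            rw [e1, e2, e3, e4, e5]
            simp [code_four]
          · have hu : typ C Y i = 3 := by omega
            rw [hu] at h31 h32 h41 h42 h43 ⊢
            norm_num at h31 h32 h41 h42 h43
            simp only [Nat.reduceSub]
            have e1 : cnt3 1 (Function.update (typ C Y) i 2) = d31 := by omega
            have e2 : cnt3 2 (Function.update (typ C Y) i 2) = d32 := by omega
            have e3 : cnt4 1 (Function.update (typ C Y) i 2) = d41 := by omega
            have e4 : cnt4 2 (Function.update (typ C Y) i 2) = d42 + 1 := by omega
            have e5 : cnt4 3 (Function.update (typ C Y) i 2) = d43 - 1 := by omega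
            rw [e1, e2, e3, e4, e5]
            simp [code_four]
      rw [sum_congr rfl (fun i _ => e i), sum_eq_cnt (typ C Y) hb (fun s v => ((v : ℕ) : ℚ) * (if code s v = 1 then wdir n (d31 - 1) d32 d41 d42 d43 0 / Yc n else if code s v = 2 then wdir n (d31 + 1) (d32 - 1) d41 d42 d43 1 / Yc n else if code s v = 4 then wdir n d31 d32 (d41 - 1) d42 d43 3 / Yc n else if code s v = 5 then wdir n d31 d32 (d41 + 1) (d42 - 1) d43 4 / Yc n else if code s v = 6 then wdir n d31 d32 d41 (d42 + 1) (d43 - 1) 5 / Yc n else 0)), W_none]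
      simp only [code_three, code_four, Nat.reduceAdd, Nat.cast_zero, mul_zero, Nat.cast_one, one_mul,
        Nat.cast_ofNat, if_true, if_false, Nat.reduceEqDiff]
      rw [← hd31, ← hd32, ← hd41, ← hd42, ← hd43]
      have hcq : (c : ℚ) = (5 : ℚ) - d31 - 2 * d32 - d41 - 2 * d42 - 3 * d43 := by
        have : c = 5 - d31 - 2 * d32 - d41 - 2 * d42 - 3 * d43 := by omega
        rw [this, Nat.cast_sub (by omega), Nat.cast_sub (by omega), Nat.cast_sub (by omega), Nat.cast_sub (by omega), Nat.cast_sub (by omega)]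
        push_cast
        ring
      have hcle : (c : ℚ) ≤ n - 22 := by rw [← hfreeq]; exact_mod_cast hfc
      have t_d31 : (d31 : ℚ) * (wdir n (d31 - 1) d32 d41 d42 d43 0 / Yc n) = (d31 : ℚ) * (raw n (d31 - 1) d32 d41 d42 d43 0 / Yc n) := by
        rcases Nat.eq_zero_or_pos d31 with h | h
        · rw [h]; simp
        · rw [wdir_eq_raw n (d31 - 1) d32 d41 d42 d43 0 (by norm_num) (by norm_num) hn0]
          rw [Nat.cast_sub h]; push_cast; linarith
      have t_d32 : (d32 : ℚ) * (2 * (wdir n (d31 + 1) (d32 - 1) d41 d42 d43 1 / Yc n)) = (d32 : ℚ) * (2 * (raw n (d31 + 1) (d32 - 1) d41 d42 d43 1 / Yc n)) := by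
        rcases Nat.eq_zero_or_pos d32 with h | h
        · rw [h]; simp
        · rw [wdir_eq_raw n (d31 + 1) (d32 - 1) d41 d42 d43 1 (by norm_num) (by norm_num) hn0]
          rw [Nat.cast_sub h]; push_cast; linarith
      have t_d41 : (d41 : ℚ) * (wdir n d31 d32 (d41 - 1) d42 d43 3 / Yc n) = (d41 : ℚ) * (raw n d31 d32 (d41 - 1) d42 d43 3 / Yc n) := by
        rcases Nat.eq_zero_or_pos d41 with h | h
        · rw [h]; simp
        · rw [wdir_eq_raw n d31 d32 (d41 - 1) d42 d43 3 (by norm_num) (by norm_num) hn0]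
          rw [Nat.cast_sub h]; push_cast; linarith
      have t_d42 : (d42 : ℚ) * (2 * (wdir n d31 d32 (d41 + 1) (d42 - 1) d43 4 / Yc n)) = (d42 : ℚ) * (2 * (raw n d31 d32 (d41 + 1) (d42 - 1) d43 4 / Yc n)) := by
        rcases Nat.eq_zero_or_pos d42 with h | h
        · rw [h]; simp
        · rw [wdir_eq_raw n d31 d32 (d41 + 1) (d42 - 1) d43 4 (by norm_num) (by norm_num) hn0]
          rw [Nat.cast_sub h]; push_cast; linarith
      have t_d43 : (d43 : ℚ) * (3 * (wdir n d31 d32 d41 (d42 + 1) (d43 - 1) 5 / Yc n)) = (d43 : ℚ) * (3 * (raw n d31 d32 d41 (d42 + 1) (d43 - 1) 5 / Yc n)) := by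
        rcases Nat.eq_zero_or_pos d43 with h | h
        · rw [h]; simp
        · rw [wdir_eq_raw n d31 d32 d41 (d42 + 1) (d43 - 1) 5 (by norm_num) (by norm_num) hn0]
          rw [Nat.cast_sub h]; push_cast; linarith
      have tF : (c : ℚ) * (wdir n d31 d32 d41 d42 d43 7 / Yc n) = (c : ℚ) * (raw n d31 d32 d41 d42 d43 7 / Yc n) := by
        rcases Nat.eq_zero_or_pos c with h | h
        · rw [h]; simp
        · rw [wdir_eq_raw n d31 d32 d41 d42 d43 7 (by norm_num) (by norm_num) hn0]
          have : (1 : ℚ) ≤ c := by exact_mod_cast h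
          linarith
      rw [t_d31, t_d32, t_d41, t_d42, t_d43, tF, hcq]
      have key := col_check n hd d31 d32 d41 d42 d43 (by omega) (by omega) (by omega)
      rw [show (1 : ℚ) / Yc n = (1 * (d31 : ℚ) * raw n (d31 - 1) d32 d41 d42 d43 0 + 2 * (d32 : ℚ) * raw n (d31 + 1) (d32 - 1) d41 d42 d43 1 + 1 * (d41 : ℚ) * raw n d31 d32 (d41 - 1) d42 d43 3 + 2 * (d42 : ℚ) * raw n d31 d32 (d41 + 1) (d42 - 1) d43 4 + 3 * (d43 : ℚ) * raw n d31 d32 d41 (d42 + 1) (d43 - 1) 5 + ((5 : ℚ) - d31 - 2 * d32 - d41 - 2 * d42 - 3 * d43) * raw n d31 d32 d41 d42 d43 7) / Yc n by rw [key]]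
      ring

/-- **THEOREM. (SP) for `2` pairwise disjoint triples and `4` pairwise disjoint quadruples at level `4` on EVERY finite ground
set** (`sz i = if i < 2 then 3 else 4`). -/
theorem puncturedNMP_mix_T2_Q4 (C : Fin 6 → Finset α) (hcard : ∀ i, (C i).card = sz i)
    (hdisj : ∀ i l, i ≠ l → Disjoint (C i) (C l)) :
    PuncturedNMP 4 ((univ : Finset (Fin 6)).biUnion (fun i => upLevel 4 (C i))) := by
  rcases Nat.lt_or_ge (Fintype.card α) 5 with h | h
  · exact puncturedNMP_of_card_le _ (by omega)
  · obtain ⟨m', hm⟩ : ∃ m', Fintype.card α = m' + 5 := ⟨Fintype.card α - 5, by omega⟩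
    exact puncturedNMP_mix_of_le m' hm C hcard hdisj

end Main

end PercRepro.PuncturedLYM.Split.TypeLift.MixT2Q4
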